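import Summits.ResolutionOfSingularities.KangarooAtlas.MizutaniPointMultiplicity
import Mathlib.RingTheory.RegularLocalRing.Polynomial
import HarnessLib

/-!
# Mizutani's conjecture — the multiplicity of the AFFINE CONE along the line `V(𝔭)` equals the multiplicity of the
# projective hypersurface at the point `𝔭`

Cell topic `Summits/ResolutionOfSingularities/KangarooAtlas` (pub-rosobs); namespace
`Summit.ResolutionOfSingularities.KangarooAtlas.Mizutani`.  Companion to the Lean transcription of the in-house
note MIZUTANI-PROOF-g59 (AI-written, AI-audited; *AI review is weaker than expert review*; not a resolution
theorem; NOT summit progress).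

The res-hironaka typing file `Literature/…/HironakaGroupSchemeMultiplicity.lean` transcribes Mizutani's
«`mult_p(Proj(S/fS)) ≥ m`» (Nagoya Math. J. 52 p. 85 L23–25) by the symbolic power `f ∈ 𝔭^{(m)} = 𝔭^m S_𝔭 ∩ S` — a
condition in the local ring `S_𝔭` of the AFFINE space `𝔸^{n+1} = Spec S` at the generic point of the line `V(𝔭)` (the
cone over the point), while Mizutani's words name the local ring `𝒪_{ℙⁿ,𝔭}` of PROJECTIVE space at the point.
`MizutaniProjectiveOrder.lean` proved the two readings agree as ORDER CONDITIONS (`mem_symbPow_iff_projGerm_mem_pow`);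
this file proves they agree as MULTIPLICITIES, i.e. as numbers (Matsumura §14): for a point `𝔭` of `ℙⁿ_k` and a nonzero
form `f ∈ 𝔭` of degree `d`,

* `adicOrder_algebraMap_eq_adicOrder_projGerm` — `ν_{S_𝔭}(f) = ν_{𝒪_{ℙⁿ,𝔭}}(f/X_i^d)`: the order of `f` in the regular local
  ring `S_𝔭` equals the order of its germ in the regular local ring `𝒪_{ℙⁿ,𝔭}` (both are `sup {m : f ∈ 𝔭^{(m)}}`);
* **`samuelMultiplicity_cone_eq_projMult`** — `e(S_𝔭/(f)) = e(𝒪_{ℙⁿ,𝔭}/(f/X_i^d)) = projMult 𝔭 hP d f`: the Samuel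
  multiplicity of the affine cone `C(V(f)) = Spec(S/fS) ⊂ 𝔸^{n+1}` at the generic point of the line over the point equals
  the multiplicity of the projective hypersurface `V(f) = Proj(S/fS) ⊂ ℙⁿ` at the point (both local rings are hypersurface
  quotients of regular local rings, where multiplicity = order, `samuelMultiplicity_quotient_span_singleton`);
* `mem_symbPow_iff_le_samuelMultiplicity_cone` — hence the res-hironaka predicate with the affine number:
  `f ∈ symbPow k 𝔭 m ↔ m ≤ e(S_𝔭/(f))`.

So every one of the three printed readings of «multiplicity `≥ m` at the point» — Hironaka's `ν_{x'}(φ/X_0^d) ≥ d` in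
`𝒪_{Proj,x'}` (Kyoto 1970 p. 154), Mizutani's `mult_p(Proj(S/fS)) ≥ m` (Samuel multiplicity), and the typing file's
`f ∈ 𝔭^{(m)}` — names the same number.

References: [Mizutani1973HironakaGroupSchemes] p. 85 L21–29; [Hironaka1970NumericalCharacters] p. 154 L24–29;
[Matsumura1987] §14 (multiplicity), Thm. 19.5 (localisations of regular rings are regular).
-/

noncomputable section

open MvPolynomial IsLocalRing Literature.RingTheory.HilbertSamuel Literature.AlgebraicGeometry.Resolution
  Literature.AlgebraicGeometry.Resolution.HironakaScheme

attribute [local instance] MvPolynomial.gradedAlgebra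

namespace Summit.ResolutionOfSingularities.KangarooAtlas.Mizutani

universe u

section Cone

variable {k : Type u} [Field k] {n : ℕ}
  (𝔭 : Ideal (MvPolynomial (Fin (n + 1)) k)) [h𝔭 : 𝔭.IsPrime]

/-- `S_𝔭` is a regular local ring (localisation of the regular ring `k[X_0, …, X_n]` at a prime; Matsumura Thm. 19.5,
Mathlib `IsRegularRing`). [cite: Matsumura1987, Thm. 19.5 (Serre: localisations of regular local rings are regular) and Thm. 19.3] -/
theorem isRegularLocalRing_localization_atPrime :
    IsRegularLocalRing (Localization.AtPrime 𝔭) :=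
  IsRegularRing.isRegularLocalRing_localization 𝔭

/-- In `S_𝔭`: `f/1 ∈ 𝔪_{S_𝔭}^m ↔ f ∈ 𝔭^{(m)}` — the res-hironaka predicate `symbPow` IS the order condition in the local
ring of the affine cone (restated from `exists_mul_mem_pow_iff_algebraMap_mem`). [cite: Mizutani1973HironakaGroupSchemes, p. 85 L23–25] -/
theorem mem_symbPow_iff_algebraMap_mem_pow (f : MvPolynomial (Fin (n + 1)) k) (m : ℕ) :
    f ∈ symbPow k 𝔭 m ↔
      algebraMap (MvPolynomial (Fin (n + 1)) k) (Localization.AtPrime 𝔭) f ∈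
        maximalIdeal (Localization.AtPrime 𝔭) ^ m :=
  exists_mul_mem_pow_iff_algebraMap_mem 𝔭 f m

/-- Hence `f ∈ 𝔭^{(m)} ↔ m ≤ ν_{S_𝔭}(f)` with the order function `adicOrder` of `S_𝔭`. [cite: Mizutani1973HironakaGroupSchemes, p. 85 L23–25; Hironaka1970NumericalCharacters, p. 154 L24–29] -/
theorem mem_symbPow_iff_le_adicOrder_algebraMap (f : MvPolynomial (Fin (n + 1)) k) (m : ℕ) :
    f ∈ symbPow k 𝔭 m ↔
      (m : ℕ∞) ≤ adicOrder (algebraMap (MvPolynomial (Fin (n + 1)) k) (Localization.AtPrime 𝔭) f) := by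
  rw [le_adicOrder_iff, mem_symbPow_iff_algebraMap_mem_pow]

variable {𝔭}

/-- **`ν_{S_𝔭}(f) = ν_{𝒪_{ℙⁿ,𝔭}}(f/X_i^d)`**: for a point `𝔭` of `ℙⁿ_k`, a chart `X_i ∉ 𝔭` and a form `f` of degree `d`, the
order of `f` in the local ring of the affine cone equals the order of its germ in the local ring of projective space
(both equal `sup {m : f ∈ 𝔭^{(m)}}`). [cite: Hironaka1970NumericalCharacters, p. 154 L24–29 (ν_{x'}(φ/X_0^d)); Mizutani1973HironakaGroupSchemes, p. 85 L23–25] -/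
theorem adicOrder_algebraMap_eq_adicOrder_projGerm (hP : IsPoint k 𝔭) {i : Fin (n + 1)}
    (hi : (X i : MvPolynomial (Fin (n + 1)) k) ∉ 𝔭) {d : ℕ} (φ : MvPolynomial (Fin (n + 1)) k)
    (hφ : φ ∈ homogeneousSubmodule (Fin (n + 1)) k d) :
    adicOrder (algebraMap (MvPolynomial (Fin (n + 1)) k) (Localization.AtPrime 𝔭) φ) =
      adicOrder (projGerm 𝔭 (X i) (Literature.AlgebraicGeometry.Motives.ProjectiveSpace.X_mem i) hi d φ hφ) :=
  ENat.eq_of_forall_natCast_le_iff fun m => by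
    rw [← mem_symbPow_iff_le_adicOrder_algebraMap 𝔭 φ m,
      mem_symbPow_iff_le_adicOrder_projGerm (Literature.AlgebraicGeometry.Motives.ProjectiveSpace.X_mem i) hi
        (isHomogeneous_of_isPoint 𝔭 hP) φ hφ m]

/-- The local ring `S_𝔭/(f)` of the affine cone `Spec(S/fS)` at the generic point of the line over a point `𝔭` of the
hypersurface is a local ring (use-site instance). [folklore] -/
theorem isLocalRing_cone_quotient {φ : MvPolynomial (Fin (n + 1)) k} (hφ𝔭 : φ ∈ 𝔭) :
    IsLocalRing (Localization.AtPrime 𝔭 ⧸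
      Ideal.span {algebraMap (MvPolynomial (Fin (n + 1)) k) (Localization.AtPrime 𝔭) φ}) := by
  haveI := isRegularLocalRing_localization_atPrime 𝔭
  refine isLocalRing_quotient_span_singleton ?_
  rw [← Localization.AtPrime.map_eq_maximalIdeal]
  exact Ideal.mem_map_of_mem _ hφ𝔭

/-- **`e(S_𝔭/(f)) = mult_𝔭(Proj(S/fS))`**: for a point `𝔭` of `ℙⁿ_k` and a nonzero form `f ∈ 𝔭` of degree `d`, the Samuel
multiplicity of the local ring of the AFFINE CONE `Spec(S/fS) ⊂ 𝔸^{n+1}` at the generic point of the line `V(𝔭)` equals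
the multiplicity `projMult 𝔭 hP d f = e(𝒪_{ℙⁿ,𝔭}/(f/X_i^d))` of the PROJECTIVE hypersurface `Proj(S/fS)` at the point —
the typing file's affine transcription and Mizutani's projective wording give the same number.  Both local rings are
hypersurface quotients of regular local rings (`S_𝔭`, `𝒪_{ℙⁿ,𝔭}`), in which multiplicity = order
(`samuelMultiplicity_quotient_span_singleton`), and the two orders agree (`adicOrder_algebraMap_eq_adicOrder_projGerm`).
[cite: Mizutani1973HironakaGroupSchemes, p. 85 L23–25 (mult_p(Proj(S/fS))); Matsumura1987, §14; Hironaka1970NumericalCharacters, p. 154 L24–29] -/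
theorem samuelMultiplicity_cone_eq_projMult (hP : IsPoint k 𝔭) {d : ℕ} {φ : MvPolynomial (Fin (n + 1)) k}
    (hφ : φ ∈ homogeneousSubmodule (Fin (n + 1)) k d) (hφ𝔭 : φ ∈ 𝔭) (hφ0 : φ ≠ 0)
    [IsLocalRing (Localization.AtPrime 𝔭 ⧸
      Ideal.span {algebraMap (MvPolynomial (Fin (n + 1)) k) (Localization.AtPrime 𝔭) φ})] :
    samuelMultiplicity (Localization.AtPrime 𝔭 ⧸
        Ideal.span {algebraMap (MvPolynomial (Fin (n + 1)) k) (Localization.AtPrime 𝔭) φ}) =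
      projMult 𝔭 hP d φ := by
  haveI := isRegularLocalRing_localization_atPrime 𝔭
  obtain ⟨i, hi⟩ := exists_X_not_mem_of_isPoint 𝔭 hP
  have hg : algebraMap (MvPolynomial (Fin (n + 1)) k) (Localization.AtPrime 𝔭) φ ∈
      maximalIdeal (Localization.AtPrime 𝔭) := by
    rw [← Localization.AtPrime.map_eq_maximalIdeal]
    exact Ideal.mem_map_of_mem _ hφ𝔭
  have hg0 : algebraMap (MvPolynomial (Fin (n + 1)) k) (Localization.AtPrime 𝔭) φ ≠ 0 := fun h =>
    hφ0 ((IsLocalization.injective (Localization.AtPrime 𝔭) 𝔭.primeCompl_le_nonZeroDivisors)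
      (by rw [h, map_zero]))
  have h := samuelMultiplicity_quotient_span_singleton hg hg0
  rw [adicOrder_algebraMap_eq_adicOrder_projGerm hP hi φ hφ, ← projMult_eq_adicOrder hP hi hφ hφ𝔭 hφ0,
    Nat.cast_inj] at h
  exact h

/-- **Mizutani's `mult_p(Proj(S/fS)) ≥ m` with the AFFINE number**: for a point `𝔭` of `ℙⁿ_k` and a nonzero form `f ∈ 𝔭`,
`f ∈ symbPow k 𝔭 m ↔ m ≤ e(S_𝔭/(f))`. [cite: Mizutani1973HironakaGroupSchemes, p. 85 L23–25; Matsumura1987, §14] -/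
theorem mem_symbPow_iff_le_samuelMultiplicity_cone (hP : IsPoint k 𝔭) {d : ℕ} {φ : MvPolynomial (Fin (n + 1)) k}
    (hφ : φ ∈ homogeneousSubmodule (Fin (n + 1)) k d) (hφ𝔭 : φ ∈ 𝔭) (hφ0 : φ ≠ 0)
    [IsLocalRing (Localization.AtPrime 𝔭 ⧸
      Ideal.span {algebraMap (MvPolynomial (Fin (n + 1)) k) (Localization.AtPrime 𝔭) φ})] (m : ℕ) :
    φ ∈ symbPow k 𝔭 m ↔
      m ≤ samuelMultiplicity (Localization.AtPrime 𝔭 ⧸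
        Ideal.span {algebraMap (MvPolynomial (Fin (n + 1)) k) (Localization.AtPrime 𝔭) φ}) := by
  rw [samuelMultiplicity_cone_eq_projMult hP hφ hφ𝔭 hφ0]
  exact mem_symbPow_iff_le_projMult hP hφ hφ0 m

/-- And `e(S_𝔭) = 1`: the local ring of the affine cone `𝔸^{n+1}` along the line is regular, of multiplicity one
(compare `samuelMultiplicity_projLocalRing`). [cite: Matsumura1987, §14 (e = 1 for regular local rings) and Thm. 19.5] -/
theorem samuelMultiplicity_localization_atPrime :
    samuelMultiplicity (Localization.AtPrime 𝔭) = 1 := by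
  haveI := isRegularLocalRing_localization_atPrime 𝔭
  exact samuelMultiplicity_of_isRegularLocalRing

end Cone

end Summit.ResolutionOfSingularities.KangarooAtlas.Mizutani

end
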